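import Mathlib
import Literature.Probability.Moments.HoeffdingCounting
import HarnessLib

/-!
# Crux `NNMonotoneHard` (stmt-ValiantsHypothesis-11617), piece (E) of `Cruxes/NNMonotoneHard/PROOF-PLAN.md`:
# the band and balance counts for uniform words

Counting estimates for the uniform measure on words `v : Fin N → Bool` (`true` = opener):
with the signed prefix sum `S_t(v) = Σ_{i < t} (v i ? 1 : -1)` (the queue-length increment),

* `card_filter_prefixSum_ge_le`, `card_filter_prefixSum_le_neg_le` — one-sided Chernoff–Hoeffding
  tails `#{v : m ≤ ±S_t(v)} ≤ exp(-m²/(2t)) · 2^N` (from the tree's counting Hoeffding inequality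
  `Literature.Probability.Moments.hoeffding_count_pi`);
* `card_filter_exists_abs_prefixSum_ge_le` — **the band estimate**: the number of words leaving
  the band `|S_t| < m` at some time `t ≤ N` is at most `2N · exp(-m²/(2N)) · 2^N`;
* `card_filter_balanced_eq_centralBinom`, `four_pow_le_card_filter_balanced` — **the balance
  estimate**: exactly `C(2K, K) ≥ 4^K / (2K)` words of length `2K` are balanced (Mathlib's
  `Nat.four_pow_le_two_mul_self_mul_centralBinom`).

In the thick-queue measure argument these make the conditioning on "balanced and never below the
floor" cost only a polynomial factor while the band is left with superpolynomially small
probability (PROOF-PLAN.md (E)–(F)).  Honest framing: elementary counting; VP ≠ VNP is not moved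
by anything here.  No definitions, no named facts.
-/

noncomputable section

-- Sub = Summit single-conjunct layout: the duplicated namespace component is mandated by the tree.
set_option linter.dupNamespace false

namespace Summit.ValiantsHypothesis.ValiantsHypothesis.Theorems.FifoMatching.NNMonotoneHard

open Finset Real

variable {N : ℕ}

/-- **Upper Chernoff–Hoeffding tail of a prefix sum of a uniform word**:
`#{v : m ≤ S_t(v)} ≤ exp(-m²/(2t)) · 2^N` for `0 < t`, `0 ≤ m`, where
`S_t(v) = Σ_{i<t} (v i ? 1 : -1)`. [folklore] -/
theorem card_filter_prefixSum_ge_le {t : ℕ} (ht : 0 < t) (htN : t ≤ N) {m : ℝ} (hm : 0 ≤ m) :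
    ((univ.filter fun v : Fin N → Bool =>
        m ≤ ∑ i : Fin N, (if (i : ℕ) < t then (if v i then (1 : ℝ) else -1) else 0)).card : ℝ)
      ≤ Real.exp (-(m ^ 2 / (2 * t))) * 2 ^ N := by
  classical
  set f : ∀ _ : Fin N, Bool → ℝ := fun i b => if (i : ℕ) < t then (if b then (1 : ℝ) else -1) else 0
    with hf
  set c : Fin N → ℝ := fun i => if (i : ℕ) < t then 1 else 0 with hc
  have hf0 : ∀ i, ∑ b, f i b = 0 := by
    intro i; by_cases h : (i : ℕ) < t <;> simp [hf, h]
  have hfc : ∀ i b, |f i b| ≤ c i := by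
    intro i b; by_cases h : (i : ℕ) < t <;> cases b <;> simp [hf, hc, h]
  have hS : ∑ i : Fin N, c i ^ 2 = t := by
    simp only [hc]
    rw [show (∑ i : Fin N, (if (i : ℕ) < t then (1 : ℝ) else 0) ^ 2)
        = ∑ i : Fin N, (if (i : ℕ) < t then (1 : ℝ) else 0) by
      refine sum_congr rfl fun i _ => ?_; split_ifs <;> norm_num]
    rw [← sum_filter, sum_const, nsmul_eq_mul, mul_one]
    have : (univ.filter fun i : Fin N => (i : ℕ) < t) = (Finset.Iio (⟨t - 1, by omega⟩ : Fin N)) ∪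
        {(⟨t - 1, by omega⟩ : Fin N)} := by
      ext i
      simp only [mem_filter, mem_univ, true_and, mem_union, Finset.mem_Iio, mem_singleton,
        Fin.lt_def, Fin.ext_iff]
      omega
    rw [this, card_union_of_disjoint (by simp), Fin.card_Iio, card_singleton]
    push_cast
    rw [Nat.cast_sub (by omega)]
    push_cast
    ring
  have hSpos : 0 < ∑ i : Fin N, c i ^ 2 := by rw [hS]; exact_mod_cast ht
  have key := Literature.Probability.Moments.hoeffding_count_pi f c hf0 hfc hm hSpos
  rw [hS] at key
  simpa [Fintype.card_bool, prod_const, card_univ, Fintype.card_fin] using key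

/-- **Lower tail**: `#{v : m ≤ -S_t(v)} ≤ exp(-m²/(2t)) · 2^N`. [folklore] -/
theorem card_filter_prefixSum_le_neg_le {t : ℕ} (ht : 0 < t) (htN : t ≤ N) {m : ℝ} (hm : 0 ≤ m) :
    ((univ.filter fun v : Fin N → Bool =>
        m ≤ -∑ i : Fin N, (if (i : ℕ) < t then (if v i then (1 : ℝ) else -1) else 0)).card : ℝ)
      ≤ Real.exp (-(m ^ 2 / (2 * t))) * 2 ^ N := by
  classical
  set f : ∀ _ : Fin N, Bool → ℝ := fun i b => if (i : ℕ) < t then (if b then (-1 : ℝ) else 1) else 0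
    with hf
  set c : Fin N → ℝ := fun i => if (i : ℕ) < t then 1 else 0 with hc
  have hf0 : ∀ i, ∑ b, f i b = 0 := by
    intro i; by_cases h : (i : ℕ) < t <;> simp [hf, h]
  have hfc : ∀ i b, |f i b| ≤ c i := by
    intro i b; by_cases h : (i : ℕ) < t <;> cases b <;> simp [hf, hc, h]
  have hS : ∑ i : Fin N, c i ^ 2 = t := by
    simp only [hc]
    rw [show (∑ i : Fin N, (if (i : ℕ) < t then (1 : ℝ) else 0) ^ 2)
        = ∑ i : Fin N, (if (i : ℕ) < t then (1 : ℝ) else 0) by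
      refine sum_congr rfl fun i _ => ?_; split_ifs <;> norm_num]
    rw [← sum_filter, sum_const, nsmul_eq_mul, mul_one]
    have : (univ.filter fun i : Fin N => (i : ℕ) < t) = (Finset.Iio (⟨t - 1, by omega⟩ : Fin N)) ∪
        {(⟨t - 1, by omega⟩ : Fin N)} := by
      ext i
      simp only [mem_filter, mem_univ, true_and, mem_union, Finset.mem_Iio, mem_singleton,
        Fin.lt_def, Fin.ext_iff]
      omega
    rw [this, card_union_of_disjoint (by simp), Fin.card_Iio, card_singleton]
    push_cast
    rw [Nat.cast_sub (by omega)]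
    push_cast
    ring
  have hSpos : 0 < ∑ i : Fin N, c i ^ 2 := by rw [hS]; exact_mod_cast ht
  have key := Literature.Probability.Moments.hoeffding_count_pi f c hf0 hfc hm hSpos
  rw [hS] at key
  have hrw : ∀ v : Fin N → Bool, ∑ i, f i (v i)
      = -∑ i : Fin N, (if (i : ℕ) < t then (if v i then (1 : ℝ) else -1) else 0) := by
    intro v
    rw [← sum_neg_distrib]
    refine sum_congr rfl fun i _ => ?_
    simp only [hf]
    split_ifs <;> norm_num
  simp_rw [hrw] at key
  simpa [Fintype.card_bool, prod_const, card_univ, Fintype.card_fin] using key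

/-- **The band estimate**: the number of words of length `N ≥ 1` whose prefix sum reaches
`|S_t| ≥ m` (`m ≥ 0`) at some time `t ≤ N` is at most `2N · exp(-m²/(2N)) · 2^N`. [folklore] -/
theorem card_filter_exists_abs_prefixSum_ge_le {m : ℝ} (hm : 0 < m) :
    ((univ.filter fun v : Fin N → Bool => ∃ t : ℕ, t ≤ N ∧
        m ≤ |∑ i : Fin N, (if (i : ℕ) < t then (if v i then (1 : ℝ) else -1) else 0)|).card : ℝ)
      ≤ 2 * N * Real.exp (-(m ^ 2 / (2 * N))) * 2 ^ N := by
  classical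
  -- abbreviations
  set S : (Fin N → Bool) → ℕ → ℝ := fun v t =>
    ∑ i : Fin N, (if (i : ℕ) < t then (if v i then (1 : ℝ) else -1) else 0) with hSdef
  have hS0 : ∀ v, S v 0 = 0 := fun v => by simp [hSdef]
  -- union bound over `t ∈ [1, N]` and the two signs
  have hsub : (univ.filter fun v : Fin N → Bool => ∃ t : ℕ, t ≤ N ∧ m ≤ |S v t|) ⊆
      (Finset.range N).biUnion fun s =>
        (univ.filter fun v => m ≤ S v (s + 1)) ∪ (univ.filter fun v => m ≤ -S v (s + 1)) := by
    intro v hv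
    simp only [mem_filter, mem_univ, true_and] at hv
    obtain ⟨t, htN, hmt⟩ := hv
    have ht0 : t ≠ 0 := by
      rintro rfl
      rw [hS0, abs_zero] at hmt
      exact absurd hmt (not_le.2 hm)
    obtain ⟨s, rfl⟩ := Nat.exists_eq_succ_of_ne_zero ht0
    rw [mem_biUnion]
    refine ⟨s, mem_range.2 (by omega), ?_⟩
    rw [mem_union, mem_filter, mem_filter]
    rcases le_abs'.1 hmt with h | h
    · exact Or.inr ⟨mem_univ _, by linarith⟩
    · exact Or.inl ⟨mem_univ _, h⟩
  have hexp : ∀ s ∈ Finset.range N,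
      Real.exp (-(m ^ 2 / (2 * ((s + 1 : ℕ) : ℝ)))) ≤ Real.exp (-(m ^ 2 / (2 * N))) := by
    intro s hs
    rw [mem_range] at hs
    apply Real.exp_le_exp.2
    apply neg_le_neg
    apply div_le_div_of_nonneg_left (sq_nonneg m) (by positivity)
    gcongr
    exact_mod_cast (by omega : s + 1 ≤ N)
  calc ((univ.filter fun v : Fin N → Bool => ∃ t : ℕ, t ≤ N ∧ m ≤ |S v t|).card : ℝ)
      ≤ (((Finset.range N).biUnion fun s =>
          (univ.filter fun v => m ≤ S v (s + 1)) ∪ (univ.filter fun v => m ≤ -S v (s + 1))).card : ℝ) := by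
        exact_mod_cast card_le_card hsub
    _ ≤ ∑ s ∈ Finset.range N,
          (((univ.filter fun v => m ≤ S v (s + 1)) ∪ (univ.filter fun v => m ≤ -S v (s + 1))).card : ℝ) := by
        exact_mod_cast card_biUnion_le
    _ ≤ ∑ s ∈ Finset.range N,
          (((univ.filter fun v => m ≤ S v (s + 1)).card : ℝ) +
            ((univ.filter fun v => m ≤ -S v (s + 1)).card : ℝ)) := by
        refine sum_le_sum fun s _ => ?_
        exact_mod_cast card_union_le _ _
    _ ≤ ∑ s ∈ Finset.range N, (2 * (Real.exp (-(m ^ 2 / (2 * N))) * 2 ^ N)) := by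
        refine sum_le_sum fun s hs => ?_
        have hs' : s + 1 ≤ N := by rw [mem_range] at hs; omega
        have h1 := card_filter_prefixSum_ge_le (N := N) (Nat.succ_pos s) hs' hm.le
        have h2 := card_filter_prefixSum_le_neg_le (N := N) (Nat.succ_pos s) hs' hm.le
        have h3 := hexp s hs
        have h4 : Real.exp (-(m ^ 2 / (2 * ((s + 1 : ℕ) : ℝ)))) * 2 ^ N ≤
            Real.exp (-(m ^ 2 / (2 * N))) * 2 ^ N :=
          mul_le_mul_of_nonneg_right h3 (by positivity)
        simp only [hSdef] at h1 h2 ⊢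
        linarith
    _ = 2 * N * Real.exp (-(m ^ 2 / (2 * N))) * 2 ^ N := by
        rw [sum_const, card_range, nsmul_eq_mul]; ring

/-- The number of balanced words of length `2K` is the central binomial coefficient. [folklore] -/
theorem card_filter_balanced_eq_centralBinom (K : ℕ) :
    (univ.filter fun v : Fin (2 * K) → Bool => (univ.filter fun i => v i = true).card = K).card
      = Nat.centralBinom K := by
  classical
  rw [Nat.centralBinom_eq_two_mul_choose]
  have hpc : (2 * K).choose K = (powersetCard K (univ : Finset (Fin (2 * K)))).card := by
    rw [card_powersetCard, card_univ, Fintype.card_fin]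
  rw [hpc]
  refine card_bij' (fun v _ => univ.filter fun i => v i = true) (fun s _ => fun i => decide (i ∈ s))
    ?_ ?_ ?_ ?_
  · intro v hv
    rw [mem_powersetCard]
    exact ⟨subset_univ _, (mem_filter.1 hv).2⟩
  · intro s hs
    rw [mem_powersetCard] at hs
    simp only [mem_filter, mem_univ, true_and, decide_eq_true_eq, filter_mem_eq_inter, univ_inter]
    convert hs.2 using 2
  · intro v _
    funext i
    simp
  · intro s _
    ext i
    simp

/-- **The balance estimate**: `4^K ≤ 2K · #{balanced words of length 2K}` for `K > 0`.
[folklore] -/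
theorem four_pow_le_card_filter_balanced {K : ℕ} (hK : 0 < K) :
    4 ^ K ≤ 2 * K *
      (univ.filter fun v : Fin (2 * K) → Bool => (univ.filter fun i => v i = true).card = K).card := by
  rw [card_filter_balanced_eq_centralBinom]
  exact Nat.four_pow_le_two_mul_self_mul_centralBinom K hK

end Summit.ValiantsHypothesis.ValiantsHypothesis.Theorems.FifoMatching.NNMonotoneHard
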